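import Literature.MathematicalPhysics.QuantumLattice.RealSpinReflectionCauchySchwarz
import Literature.Probability.LatticeModels.GaussianDominationProofs
import HarnessLib

/-!
# Gaussian domination for real-valued spins on the even torus (Friedli–Velenik 2017, Prop. 10.27)

Proofs-only file (topic `Literature/MathematicalPhysics/QuantumLattice`; theorems only, no definition,
no named fact). Second step (after `RealSpinReflectionCauchySchwarz`) of the port of Gaussian
domination from the tree's Ising version (`Probability/LatticeModels/GaussianDominationProofs.lean`,
finite sums over `{±1}` configurations; Friedli–Velenik 2017, §10.5.3) to **real-valued spins with
an arbitrary single-site probability measure `ν` on `ℝ` having all moments** (Friedli–Velenik's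
`O(N)`-type setting with `N = 1` and general reference measure `ρ`; the lattice `φ⁴` case
`ν ∝ e^{-gu⁴-κu²} du`): for the functional

  `Z(h) = ∫ exp{-(β/2) ∑_{{x,y} ∈ E} (φ_x - φ_y + h_x - h_y)²} ⊗_x dν(φ_x)`

(the tree's `gradForm`; written out, no definition is introduced) on the nearest-neighbour torus
`(ℤ/Lℤ)ᵈ` with `L` even, `L ≥ 4`, and `β ≥ 0`:

  **`realGaussZ_le_realGaussZ_zero`: `Z(h) ≤ Z(0)` for every real field `h`.**

## Proof (Friedli–Velenik 2017, proof of Prop. 10.27, pp. 504–505, as in `GaussianDominationProofs`)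

1. `real_exponent_reflect_split` — for a reflection `θ` of a finite graph with positive half `P`
   (involutive automorphism exchanging `P` and its complement, crossing edges `{x, θx}`):
   `-(β/2)∑_E(φ_x-φ_y+g_x-g_y)² = A_g(φ) + A_{g∘θ}(φ∘θ) + β∑_{x crossing}(φ_x+g_x)(φ_{θx}+g_{θx})`
   with the half exponent `A_g(φ) = -(β/2)[∑_{{x,y}⊆P}(φ_x-φ_y+g_x-g_y)² + ∑_{x crossing}(φ_x+g_x)²]`,
   which reads the `P`-coordinates only (the edge decomposition is the tree's
   `sum_edgeFinset_reflect_split`).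
2. `realGaussZ_sq_le_reflect` — hence `Z(h) = ∫ e^{A_h(φ)} e^{A_{h∘θ}(φθ)} e^{β∑(φ_x+h_x)(φ_{θx}+h_{θx})} dμ`
   is an exponential kernel of `RealSpinReflectionCauchySchwarz`, whose Cauchy–Schwarz inequality
   (`integral_reflect_expKernel_sq_le`: reflection positivity of the product measure; the
   dominations are bounded because `A_g` contains `-(β/2)∑_{x crossing}(φ_x+g_x)²`) gives
   **`Z(h)² ≤ Z(h⁺) Z(h⁻)`** with the symmetrised fields `h⁺ = reflPlus θ P h`, `h⁻ = reflMinus θ P h`.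
3. The descent on the number of bad bonds (Kennedy–Lieb–Shastry; the tree's combinatorics
   `badBonds_reflPlus_add_reflMinus`, the torus bond reflections `Torus.reflectBetweenSites` with
   their geometry `Torus.torusGraph_adj_reflectBetweenSites_iff`,
   `Torus.mem_halfBetweenSites_iff_reflect_not_mem`, `Torus.eq_reflectBetweenSites_of_adj`,
   `Torus.add_single_mem_halfBetweenSites`) — verbatim, with the integral functional.

## Relation to `Probability/LatticeModels/NVectorInfraredBoundProofs.lean`

That file proves Gaussian domination (`NVector.vZ_le_vZ_zero`) for `ν`-component spins with a
single-spin measure `ρ` **supported in a compact set** (`ρ Kᶜ = 0`, `IsCompact K`), which makes all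
integrands bounded. The lattice `φ⁴` single-site law `∝ e^{-gu⁴-κu²}du` has unbounded support; the
present scalar (`N = 1`) version assumes instead that `ν` is a probability measure with all
polynomial moments (`∀ n, Integrable (fun u => (1 + |u|)^n) ν`), the unboundedness being handled
in the Cauchy–Schwarz step by the domination hypotheses of `integral_reflect_expKernel_sq_le`
(the factor `-(β/2)∑_{x crossing}(φ_x+g_x)²` of the half exponent).

## References

* S. Friedli, Y. Velenik, *Statistical Mechanics of Lattice Systems* (CUP 2017), §10.5.3,
  Prop. 10.27, eq. (10.43), Lemma 10.28 and the proof of Prop. 10.27 (pp. 504–505) [FriedliVelenik2017].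
* J. Fröhlich, B. Simon, T. Spencer, Comm. Math. Phys. 50 (1976) 79–95 (Gaussian domination for
  `φ⁴`-type lattice fields) [FroehlichSimonSpencer1976].
* J. Fröhlich, R. Israel, E. H. Lieb, B. Simon, Comm. Math. Phys. 62 (1978), §2 [FILS1978].
* T. Kennedy, E. H. Lieb, B. S. Shastry, J. Stat. Phys. 53 (1988) 1019, p. 1029 (the finite
  descent) [KennedyLiebShastry1988].
-/

noncomputable section

open MeasureTheory ProbabilityTheory Filter Topology Finset
open Literature.Probability.LatticeModels

namespace Literature.MathematicalPhysics.QuantumLattice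

/-! ### 1. The exponent split for real fields -/

section Split

variable {V : Type*} [Fintype V] [DecidableEq V] {G : SimpleGraph V} [DecidableRel G.Adj]
  {θ : V ≃ V} {P : Finset V}

/-- **The exponent of `Z(h)` split along a reflection, for real fields**:
`-(β/2)∑_E(φ_x - φ_y + g_x - g_y)² = A_g(φ) + A_{g∘θ}(φ∘θ) + β∑_{x crossing}(φ_x + g_x)(φ_{θx} + g_{θx})`,
`A_g(φ) = -(β/2)[∑_{{x,y} ⊆ P}(φ_x - φ_y + g_x - g_y)² + ∑_{x crossing}(φ_x + g_x)²]`
(Friedli–Velenik 2017, proof of Prop. 10.27). [cite: FriedliVelenik2017, §10.5.3, proof of Prop. 10.27] -/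
theorem real_exponent_reflect_split (hθ : ∀ x, θ (θ x) = x)
    (hadj : ∀ x y, G.Adj (θ x) (θ y) ↔ G.Adj x y) (hP : ∀ x, x ∈ P ↔ θ x ∉ P)
    (hcross : ∀ x y, x ∈ P → y ∉ P → G.Adj x y → y = θ x) (β : ℝ) (g φ : V → ℝ) :
    -(β / 2) * gradForm G (fun x => φ x + g x) (fun x => φ x + g x) =
      -(β / 2) * (∑ e ∈ innerEdges G P,
          Sym2.lift ⟨fun x y => (φ x - φ y + (g x - g y)) ^ 2, fun x y => by ring⟩ e +
        ∑ x ∈ crossSites G θ P, (φ x + g x) ^ 2) +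
      -(β / 2) * (∑ e ∈ innerEdges G P,
          Sym2.lift ⟨fun x y => (φ (θ x) - φ (θ y) + (g (θ x) - g (θ y))) ^ 2, fun x y => by ring⟩ e +
        ∑ x ∈ crossSites G θ P, (φ (θ x) + g (θ x)) ^ 2) +
      β * ∑ x ∈ crossSites G θ P, (φ x + g x) * (φ (θ x) + g (θ x)) := by
  unfold gradForm
  rw [sum_edgeFinset_reflect_split hθ hadj hP hcross]
  have hin : ∑ e ∈ innerEdges G P, Sym2.lift ⟨fun x y =>
      (φ x + g x - (φ y + g y)) * (φ x + g x - (φ y + g y)), fun x y => by ring⟩ e =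
      ∑ e ∈ innerEdges G P, Sym2.lift ⟨fun x y => (φ x - φ y + (g x - g y)) ^ 2,
        fun x y => by ring⟩ e := by
    refine Finset.sum_congr rfl fun e _ => ?_
    induction e using Sym2.ind with
    | _ x y => simp only [Sym2.lift_mk]; ring
  have hout : ∑ e ∈ innerEdges G P, Sym2.lift ⟨fun x y =>
      (φ x + g x - (φ y + g y)) * (φ x + g x - (φ y + g y)), fun x y => by ring⟩ (Sym2.map θ e) =
      ∑ e ∈ innerEdges G P, Sym2.lift ⟨fun x y =>
        (φ (θ x) - φ (θ y) + (g (θ x) - g (θ y))) ^ 2, fun x y => by ring⟩ e := by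
    refine Finset.sum_congr rfl fun e _ => ?_
    induction e using Sym2.ind with
    | _ x y => rw [Sym2.map_mk]; simp only [Sym2.lift_mk]; ring
  have hcr : ∑ x ∈ crossSites G θ P, Sym2.lift ⟨fun x y =>
      (φ x + g x - (φ y + g y)) * (φ x + g x - (φ y + g y)), fun x y => by ring⟩ s(x, θ x) =
      ∑ x ∈ crossSites G θ P, ((φ x + g x) - (φ (θ x) + g (θ x))) ^ 2 := by
    refine Finset.sum_congr rfl fun x _ => ?_
    simp only [Sym2.lift_mk]
    ring
  rw [hin, hout, hcr, sum_sub_sq]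
  ring

/-- The half exponent reads the `P`-coordinates only. [folklore] -/
theorem dependsOn_halfExponent_real (β : ℝ) (g : V → ℝ) :
    DependsOn (fun φ : V → ℝ => -(β / 2) * (∑ e ∈ innerEdges G P,
        Sym2.lift ⟨fun x y => (φ x - φ y + (g x - g y)) ^ 2, fun x y => by ring⟩ e +
      ∑ x ∈ crossSites G θ P, (φ x + g x) ^ 2)) (P : Set V) := by
  intro φ φ' h
  simp only
  congr 2
  · refine Finset.sum_congr rfl fun e he => ?_
    have hmem := fun z => mem_of_mem_innerEdges (G := G) (P := P) he (z := z)
    revert hmem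
    induction e using Sym2.ind with
    | _ x y =>
      intro hmem
      simp only [Sym2.lift_mk]
      rw [h _ (hmem x (Sym2.mem_mk_left x y)), h _ (hmem y (Sym2.mem_mk_right x y))]
  · exact Finset.sum_congr rfl fun x hx => by rw [h _ (mem_of_mem_crossSites hx)]

/-- The half exponent depends on the field only through its values on `P`. [folklore] -/
theorem halfExponent_real_congr (β : ℝ) {g g' : V → ℝ} (hg : ∀ x ∈ P, g x = g' x) (φ : V → ℝ) :
    -(β / 2) * (∑ e ∈ innerEdges G P,
        Sym2.lift ⟨fun x y => (φ x - φ y + (g x - g y)) ^ 2, fun x y => by ring⟩ e +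
      ∑ x ∈ crossSites G θ P, (φ x + g x) ^ 2) =
    -(β / 2) * (∑ e ∈ innerEdges G P,
        Sym2.lift ⟨fun x y => (φ x - φ y + (g' x - g' y)) ^ 2, fun x y => by ring⟩ e +
      ∑ x ∈ crossSites G θ P, (φ x + g' x) ^ 2) := by
  congr 2
  · refine Finset.sum_congr rfl fun e he => ?_
    have hmem := fun z => mem_of_mem_innerEdges (G := G) (P := P) he (z := z)
    revert hmem
    induction e using Sym2.ind with
    | _ x y =>
      intro hmem
      simp only [Sym2.lift_mk]
      rw [hg x (hmem x (Sym2.mem_mk_left x y)), hg y (hmem y (Sym2.mem_mk_right x y))]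
  · exact Finset.sum_congr rfl fun x hx => by rw [hg x (mem_of_mem_crossSites hx)]

/-- The half exponent is at most `-(β/2) ∑_{x crossing}(φ_x + g_x)²` for `β ≥ 0`. [folklore] -/
theorem halfExponent_real_le {β : ℝ} (hβ : 0 ≤ β) (g φ : V → ℝ) :
    -(β / 2) * (∑ e ∈ innerEdges G P,
        Sym2.lift ⟨fun x y => (φ x - φ y + (g x - g y)) ^ 2, fun x y => by ring⟩ e +
      ∑ x ∈ crossSites G θ P, (φ x + g x) ^ 2) ≤
    -(β / 2 * ∑ x ∈ crossSites G θ P, (φ x + g x) ^ 2) := by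
  have hin : 0 ≤ ∑ e ∈ innerEdges G P,
      Sym2.lift ⟨fun x y => (φ x - φ y + (g x - g y)) ^ 2, fun x y => by ring⟩ e :=
    Finset.sum_nonneg fun e _ => by
      induction e using Sym2.ind with
      | _ x y => simp only [Sym2.lift_mk]; exact sq_nonneg _
  nlinarith

/-- Measurability of the half exponent as a function of the field. [folklore] -/
theorem measurable_halfExponent_real (β : ℝ) (g : V → ℝ) :
    Measurable fun φ : V → ℝ => -(β / 2) * (∑ e ∈ innerEdges G P,
        Sym2.lift ⟨fun x y => (φ x - φ y + (g x - g y)) ^ 2, fun x y => by ring⟩ e +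
      ∑ x ∈ crossSites G θ P, (φ x + g x) ^ 2) := by
  refine Measurable.const_mul (Measurable.add (Finset.measurable_sum _ fun e _ => ?_)
    (Finset.measurable_sum _ fun x _ => ((measurable_pi_apply x).add_const _).pow_const _)) _
  induction e using Sym2.ind with
  | _ x y =>
    simp only [Sym2.lift_mk]
    exact (((measurable_pi_apply x).sub (measurable_pi_apply y)).add_const _).pow_const _

end Split

/-! ### 2. Polynomial integrability under the product measure -/

section Moments

variable {V : Type*} [Fintype V] (ν : Measure ℝ) [IsProbabilityMeasure ν]

/-- Under `⊗_V ν` with all moments, bounded multiples of products of affine coordinate functions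
are integrable: if `|F| ≤ 1` then `F · ∏_{m<n} (φ_{v_m} + c_m)` is integrable (bound by
`C ∏_x (1 + |φ_x|)ⁿ`). [folklore] -/
theorem integrable_mul_prod_affine (hν : ∀ n : ℕ, Integrable (fun u : ℝ => (1 + |u|) ^ n) ν)
    {F : (V → ℝ) → ℝ} (hFm : Measurable F) (hF : ∀ φ, |F φ| ≤ 1) {n : ℕ} (v : Fin n → V)
    (c : Fin n → ℝ) :
    Integrable (fun φ : V → ℝ => F φ * ∏ m, (φ (v m) + c m)) (Measure.pi fun _ : V => ν) := by
  classical
  set K : ℝ := ∏ m : Fin n, (1 + |c m|) with hK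
  have hK0 : 0 ≤ K := Finset.prod_nonneg fun m _ => by positivity
  -- the dominating function
  have hdom : Integrable (fun φ : V → ℝ => K * ∏ x : V, (1 + |φ x|) ^ n) (Measure.pi fun _ : V => ν) := by
    have h := Integrable.fintype_prod (ι := V) (f := fun (_ : V) (u : ℝ) => (1 + |u|) ^ n)
      (μ := fun _ => ν) fun _ => hν n
    exact h.const_mul K
  refine hdom.mono' ?_ (Eventually.of_forall fun φ => ?_)
  · exact (hFm.mul (Finset.measurable_prod _ fun m _ =>
      (measurable_pi_apply (v m)).add_const _)).aestronglyMeasurable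
  · rw [Real.norm_eq_abs, abs_mul, Finset.abs_prod]
    have h1 : ∀ m, |φ (v m) + c m| ≤ (1 + |c m|) * ∏ x : V, (1 + |φ x|) := by
      intro m
      have hx : 1 + |φ (v m)| ≤ ∏ x : V, (1 + |φ x|) := by
        rw [← Finset.mul_prod_erase Finset.univ (fun x : V => 1 + |φ x|) (Finset.mem_univ (v m))]
        refine le_mul_of_one_le_right (by positivity) ?_
        exact Finset.prod_induction _ (fun r : ℝ => 1 ≤ r)
          (fun a b ha hb => one_le_mul_of_one_le_of_one_le ha hb) le_rfl
          (fun x _ => by linarith [abs_nonneg (φ x)])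
      have hprod1 : 1 ≤ ∏ x : V, (1 + |φ x|) :=
        (le_add_of_nonneg_right (abs_nonneg _)).trans hx
      calc |φ (v m) + c m| ≤ |φ (v m)| + |c m| := abs_add_le _ _
        _ ≤ (1 + |c m|) * ∏ x : V, (1 + |φ x|) := by nlinarith [abs_nonneg (c m), abs_nonneg (φ (v m))]
    calc |F φ| * ∏ m, |φ (v m) + c m| ≤ 1 * ∏ m : Fin n, ((1 + |c m|) * ∏ x : V, (1 + |φ x|)) :=
          mul_le_mul (hF φ) (Finset.prod_le_prod (fun m _ => abs_nonneg _) fun m _ => h1 m)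
            (Finset.prod_nonneg fun m _ => abs_nonneg _) zero_le_one
      _ = K * ∏ x : V, (1 + |φ x|) ^ n := by
          rw [one_mul, Finset.prod_mul_distrib, Finset.prod_const, Finset.card_univ, Fintype.card_fin,
            ← Finset.prod_pow]

end Moments

/-! ### 3. `Z(h)² ≤ Z(h⁺) Z(h⁻)` -/

section CauchySchwarz

variable {V : Type*} [Fintype V] [DecidableEq V] {G : SimpleGraph V} [DecidableRel G.Adj]
  (ν : Measure ℝ) [IsProbabilityMeasure ν] {θ : V ≃ V} {P : Finset V}

omit [DecidableEq V] in
/-- The integrand of `Z(h)` lies in `(0, 1]` for `β ≥ 0`; `Z(h)` is a well-defined positive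
number. [folklore] -/
theorem integrable_realGaussZ {β : ℝ} (hβ : 0 ≤ β) (h : V → ℝ) :
    Integrable (fun φ : V → ℝ => Real.exp (-(β / 2) *
      gradForm G (fun x => φ x + h x) (fun x => φ x + h x))) (Measure.pi fun _ : V => ν) := by
  refine (integrable_const (1 : ℝ)).mono' ?_ (Eventually.of_forall fun φ => ?_)
  · refine (Real.measurable_exp.comp (Measurable.const_mul ?_ _)).aestronglyMeasurable
    unfold gradForm
    refine Finset.measurable_sum _ fun e _ => ?_
    induction e using Sym2.ind with
    | _ x y =>
      simp only [gradForm_term_mk]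
      exact (((measurable_pi_apply x).add_const _).sub ((measurable_pi_apply y).add_const _)).mul
        (((measurable_pi_apply x).add_const _).sub ((measurable_pi_apply y).add_const _))
  · rw [Real.norm_eq_abs, abs_of_pos (Real.exp_pos _), Real.exp_le_one_iff]
    have := gradForm_self_nonneg (G := G) (fun x => φ x + h x)
    nlinarith

omit [DecidableEq V] in
/-- `Z(h) > 0`. [folklore] -/
theorem realGaussZ_pos {β : ℝ} (hβ : 0 ≤ β) (h : V → ℝ) :
    0 < ∫ φ, Real.exp (-(β / 2) * gradForm G (fun x => φ x + h x) (fun x => φ x + h x))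
      ∂(Measure.pi fun _ : V => ν) :=
  integral_exp_pos (integrable_realGaussZ ν hβ h)

/-- **`Z(h)² ≤ Z(h⁺) Z(h⁻)` for real spins** (Friedli–Velenik 2017, proof of Prop. 10.27 with
Lemma 10.28): for a reflection `θ` of a finite graph with positive half `P`, a single-site
probability measure with all moments, and `β ≥ 0`. [cite: FriedliVelenik2017, §10.5.3, Lemma 10.28 and proof of Prop. 10.27] -/
theorem realGaussZ_sq_le_reflect (hν : ∀ n : ℕ, Integrable (fun u : ℝ => (1 + |u|) ^ n) ν)
    (hθ : ∀ x, θ (θ x) = x) (hadj : ∀ x y, G.Adj (θ x) (θ y) ↔ G.Adj x y)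
    (hP : ∀ x, x ∈ P ↔ θ x ∉ P) (hcross : ∀ x y, x ∈ P → y ∉ P → G.Adj x y → y = θ x)
    {β : ℝ} (hβ : 0 ≤ β) (h : V → ℝ) :
    (∫ φ, Real.exp (-(β / 2) * gradForm G (fun x => φ x + h x) (fun x => φ x + h x))
        ∂(Measure.pi fun _ : V => ν)) ^ 2 ≤
      (∫ φ, Real.exp (-(β / 2) * gradForm G (fun x => φ x + reflPlus θ P h x)
          (fun x => φ x + reflPlus θ P h x)) ∂(Measure.pi fun _ : V => ν)) *
        ∫ φ, Real.exp (-(β / 2) * gradForm G (fun x => φ x + reflMinus θ P h x)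
          (fun x => φ x + reflMinus θ P h x)) ∂(Measure.pi fun _ : V => ν) := by
  -- the half exponent as a function of (field, configuration)
  set A : (V → ℝ) → (V → ℝ) → ℝ := fun g φ => -(β / 2) * (∑ e ∈ innerEdges G P,
      Sym2.lift ⟨fun x y => (φ x - φ y + (g x - g y)) ^ 2, fun x y => by ring⟩ e +
    ∑ x ∈ crossSites G θ P, (φ x + g x) ^ 2) with hA
  -- the kernel form of `Z`
  have hZ : ∀ g : V → ℝ, ∫ φ, Real.exp (-(β / 2) * gradForm G (fun x => φ x + g x) (fun x => φ x + g x))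
      ∂(Measure.pi fun _ : V => ν) =
      ∫ φ, Real.exp (A g φ) * Real.exp (A (g ∘ θ) (fun x => φ (θ x))) *
        Real.exp (β * ∑ c : ↥(crossSites G θ P), (fun (c : ↥(crossSites G θ P)) (ψ : V → ℝ) => ψ c + g c) c φ *
          (fun (c : ↥(crossSites G θ P)) (ψ : V → ℝ) => ψ c + g (θ c)) c (fun x => φ (θ x)))
        ∂(Measure.pi fun _ : V => ν) := by
    intro g
    refine integral_congr_ae (Eventually.of_forall fun φ => ?_)
    simp only
    rw [real_exponent_reflect_split hθ hadj hP hcross β g φ, Real.exp_add, Real.exp_add,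
      Finset.sum_coe_sort (crossSites G θ P) (fun x => (φ x + g x) * (φ (θ x) + g (θ x)))]
    simp only [hA, Function.comp_apply]
  -- hypotheses of the kernel Cauchy–Schwarz, for a field `g` and a shift `s` of the features
  have hW : ∀ g : V → ℝ, Measurable (fun φ => Real.exp (A g φ)) ∧
      DependsOn (fun φ => Real.exp (A g φ)) (P : Set V) ∧
      (∀ φ, |Real.exp (A g φ)| * Real.exp (β / 2 * ∑ c : ↥(crossSites G θ P), (φ c + g c) ^ 2) ≤ 1) ∧
      (∀ (s : V → ℝ) (n : ℕ) (v : Fin n → ↥(crossSites G θ P)),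
        Integrable (fun φ : V → ℝ => Real.exp (A g φ) * ∏ m, (φ (v m) + s (v m)))
          (Measure.pi fun _ : V => ν)) := by
    intro g
    have hm : Measurable fun φ => Real.exp (A g φ) :=
      Real.measurable_exp.comp (measurable_halfExponent_real (G := G) (θ := θ) (P := P) β g)
    have hle1 : ∀ φ, |Real.exp (A g φ)| ≤ 1 := fun φ => by
      rw [abs_of_pos (Real.exp_pos _), Real.exp_le_one_iff]
      refine (halfExponent_real_le (G := G) (θ := θ) (P := P) hβ g φ).trans ?_
      have : 0 ≤ ∑ x ∈ crossSites G θ P, (φ x + g x) ^ 2 := Finset.sum_nonneg fun x _ => sq_nonneg _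
      nlinarith
    refine ⟨hm, ?_, ?_, ?_⟩
    · intro φ φ' hφ
      exact congrArg Real.exp (dependsOn_halfExponent_real (G := G) (θ := θ) (P := P) β g hφ)
    · intro φ
      rw [abs_of_pos (Real.exp_pos _), ← Real.exp_add, Real.exp_le_one_iff,
        Finset.sum_coe_sort (crossSites G θ P) (fun x => (φ x + g x) ^ 2)]
      have := halfExponent_real_le (G := G) (θ := θ) (P := P) hβ g φ
      simp only [hA]
      linarith
    · intro s n v
      exact integrable_mul_prod_affine ν hν hm hle1 (fun m => ((v m : ↥(crossSites G θ P)) : V))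
        (fun m => s (v m))
  -- features
  have hpm : ∀ (s : V → ℝ) (c : ↥(crossSites G θ P)), Measurable fun ψ : V → ℝ => ψ c + s c :=
    fun s c => (measurable_pi_apply _).add_const _
  have hpP : ∀ (s : V → ℝ) (c : ↥(crossSites G θ P)), DependsOn (fun ψ : V → ℝ => ψ c + s c) (P : Set V) :=
    fun s c ψ ψ' hψ => by simp only; rw [hψ _ (mem_of_mem_crossSites c.2)]
  -- apply the kernel Cauchy–Schwarz with Φ = e^{A_h}, Ψ = e^{A_{h∘θ}}, p_c = φ_c + h_c, q_c = φ_c + h_{θc}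
  obtain ⟨hΦm, hΦP, hKΦ, hΦi⟩ := hW h
  obtain ⟨hΨm, hΨP, hKΨ', hΨi⟩ := hW (h ∘ θ)
  have hKΨ : ∀ φ : V → ℝ, |Real.exp (A (h ∘ θ) φ)| *
      Real.exp (β / 2 * ∑ c : ↥(crossSites G θ P), (φ c + h (θ c)) ^ 2) ≤ 1 := fun φ => by
    simpa only [Function.comp_apply] using hKΨ' φ
  have hcs := integral_reflect_expKernel_sq_le ν θ P hP hβ hΦm hΨm (hpm h) (hpm (h ∘ θ)) hΦP hΨP
    (hpP h) (hpP (h ∘ θ)) (hΦi h) (by simpa only [Function.comp_apply] using hΨi (h ∘ θ)) hKΦ hKΨ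
  -- identify the three kernels with `Z(h)`, `Z(h⁺)`, `Z(h⁻)`
  rw [hZ h, hZ (reflPlus θ P h), hZ (reflMinus θ P h)]
  have eP : ∀ φ : V → ℝ, A (reflPlus θ P h) φ = A h φ := fun φ =>
    halfExponent_real_congr (G := G) (θ := θ) (P := P) β (fun x hx => by simp [reflPlus, hx]) φ
  have eP' : ∀ φ : V → ℝ, A (reflPlus θ P h ∘ θ) φ = A h φ := fun φ =>
    halfExponent_real_congr (G := G) (θ := θ) (P := P) β (fun x hx => by
      have hθx : θ x ∉ P := (hP x).1 hx
      simp [reflPlus, hθx, hθ]) φ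
  have eM : ∀ φ : V → ℝ, A (reflMinus θ P h) φ = A (h ∘ θ) φ := fun φ =>
    halfExponent_real_congr (G := G) (θ := θ) (P := P) β (fun x hx => by simp [reflMinus, hx]) φ
  have eM' : ∀ φ : V → ℝ, A (reflMinus θ P h ∘ θ) φ = A (h ∘ θ) φ := fun φ =>
    halfExponent_real_congr (G := G) (θ := θ) (P := P) β (fun x hx => by
      have hθx : θ x ∉ P := (hP x).1 hx
      simp [reflMinus, hθx]) φ
  have cP : ∀ c : ↥(crossSites G θ P), reflPlus θ P h c = h c ∧ reflPlus θ P h (θ c) = h c := by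
    intro c
    have hc : (c : V) ∈ P := mem_of_mem_crossSites c.2
    have hθc : θ c ∉ P := (hP c).1 hc
    simp [reflPlus, hc, hθc, hθ]
  have cM : ∀ c : ↥(crossSites G θ P), reflMinus θ P h c = h (θ c) ∧ reflMinus θ P h (θ c) = h (θ c) := by
    intro c
    have hc : (c : V) ∈ P := mem_of_mem_crossSites c.2
    have hθc : θ c ∉ P := (hP c).1 hc
    simp [reflMinus, hc, hθc]
  have hplus : ∫ φ, Real.exp (A (reflPlus θ P h) φ) * Real.exp (A (reflPlus θ P h ∘ θ) (fun x => φ (θ x))) *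
      Real.exp (β * ∑ c : ↥(crossSites G θ P), (φ c + reflPlus θ P h c) * (φ (θ c) + reflPlus θ P h (θ c)))
        ∂(Measure.pi fun _ : V => ν) =
      ∫ φ, Real.exp (A h φ) * Real.exp (A h (fun x => φ (θ x))) *
        Real.exp (β * ∑ c : ↥(crossSites G θ P), (φ c + h c) * (φ (θ c) + h c))
          ∂(Measure.pi fun _ : V => ν) := by
    refine integral_congr_ae (Eventually.of_forall fun φ => ?_)
    simp only [eP, eP', (cP _).1, (cP _).2]
  have hminus : ∫ φ, Real.exp (A (reflMinus θ P h) φ) * Real.exp (A (reflMinus θ P h ∘ θ) (fun x => φ (θ x))) *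
      Real.exp (β * ∑ c : ↥(crossSites G θ P), (φ c + reflMinus θ P h c) * (φ (θ c) + reflMinus θ P h (θ c)))
        ∂(Measure.pi fun _ : V => ν) =
      ∫ φ, Real.exp (A (h ∘ θ) φ) * Real.exp (A (h ∘ θ) (fun x => φ (θ x))) *
        Real.exp (β * ∑ c : ↥(crossSites G θ P), (φ c + h (θ c)) * (φ (θ c) + h (θ c)))
          ∂(Measure.pi fun _ : V => ν) := by
    refine integral_congr_ae (Eventually.of_forall fun φ => ?_)
    simp only [eM, eM', (cM _).1, (cM _).2]
  simp only [] at hplus hminus ⊢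
  rw [hplus, hminus]
  simpa only [Function.comp_apply] using hcs

end CauchySchwarz

/-! ### 4. The descent on the torus: `Z(h) ≤ Z(0)` -/

section Descent

variable {V : Type*} [Fintype V] [DecidableEq V] {G : SimpleGraph V} [DecidableRel G.Adj]
  (ν : Measure ℝ) [IsProbabilityMeasure ν]

omit [DecidableEq V] [IsProbabilityMeasure ν] in
/-- A field without bad bonds does not change `Z`: `N(g) = 0 ⇒ Z(g) = Z(0)`. [cite: FriedliVelenik2017, §10.5.3, proof of Prop. 10.27] -/
theorem realGaussZ_eq_of_badBonds_eq_zero (β : ℝ) {g : V → ℝ} (hg : badBonds G g = 0) :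
    ∫ φ, Real.exp (-(β / 2) * gradForm G (fun x => φ x + g x) (fun x => φ x + g x))
        ∂(Measure.pi fun _ : V => ν) =
      ∫ φ, Real.exp (-(β / 2) * gradForm G φ φ) ∂(Measure.pi fun _ : V => ν) := by
  refine integral_congr_ae (Eventually.of_forall fun φ => ?_)
  simp only
  congr 2
  unfold gradForm
  refine Finset.sum_congr rfl fun e he => ?_
  have hterm := (Finset.sum_eq_zero_iff.1 hg) e he
  induction e using Sym2.ind with
  | _ x y =>
    rw [badInd_mk] at hterm
    have hxy : g x = g y := by
      by_contra h
      rw [if_neg h] at hterm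
      exact one_ne_zero hterm
    simp only [gradForm_term_mk, hxy]
    ring

end Descent

section TorusDescent

variable {d L : ℕ} [NeZero L] (ν : Measure ℝ) [IsProbabilityMeasure ν]

/-- **Gaussian domination for real-valued spins on the even torus** (Friedli–Velenik 2017,
Prop. 10.27, eq. (10.43), for `N = 1` and a general single-site probability measure `ν` on `ℝ`
with all moments; Fröhlich–Simon–Spencer 1976 for `φ⁴`-type fields): for `L` even, `L ≥ 4`,
`β ≥ 0` and every real field `h` on `(ℤ/Lℤ)ᵈ`,
`∫ e^{-(β/2)∑_E(φ_x-φ_y+h_x-h_y)²} ⊗dν ≤ ∫ e^{-(β/2)∑_E(φ_x-φ_y)²} ⊗dν`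
— the descent on the number of bad bonds over the finite set of fields with values in the range
of `h` (Kennedy–Lieb–Shastry), using `realGaussZ_sq_le_reflect` at the bond-bisecting
reflections of the torus. [cite: FriedliVelenik2017, Prop. 10.27, eq. (10.43)] -/
theorem realGaussZ_le_realGaussZ_zero (hL : Even L) (hL4 : 4 ≤ L)
    (hν : ∀ n : ℕ, Integrable (fun u : ℝ => (1 + |u|) ^ n) ν) {β : ℝ} (hβ : 0 ≤ β)
    (h : TorusSite d L → ℝ) :
    ∫ φ, Real.exp (-(β / 2) * gradForm (torusGraph d L) (fun x => φ x + h x) (fun x => φ x + h x))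
        ∂(Measure.pi fun _ : TorusSite d L => ν) ≤
      ∫ φ, Real.exp (-(β / 2) * gradForm (torusGraph d L) φ φ)
        ∂(Measure.pi fun _ : TorusSite d L => ν) := by
  classical
  set Gr := torusGraph d L
  -- the functional
  set Z : (TorusSite d L → ℝ) → ℝ := fun g => ∫ φ, Real.exp (-(β / 2) *
    gradForm Gr (fun x => φ x + g x) (fun x => φ x + g x)) ∂(Measure.pi fun _ : TorusSite d L => ν)
    with hZdef
  have hZpos : ∀ g, 0 < Z g := fun g => realGaussZ_pos (G := Gr) ν hβ g
  change Z h ≤ _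
  -- the finite set of fields with values in the range of `h`
  set R : Finset ℝ := Finset.univ.image h with hR
  set F : Finset (TorusSite d L → ℝ) := Fintype.piFinset fun _ => R with hF
  have hhF : h ∈ F := by
    rw [hF, Fintype.mem_piFinset]
    intro x
    exact Finset.mem_image_of_mem h (Finset.mem_univ x)
  have hFne : F.Nonempty := ⟨h, hhF⟩
  obtain ⟨g₀, hg₀F, hg₀max⟩ := Finset.exists_max_image F Z hFne
  set Fmax := F.filter fun g => Z g = Z g₀ with hFmax
  have hFmaxne : Fmax.Nonempty := ⟨g₀, by simp [hFmax, hg₀F]⟩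
  obtain ⟨g, hgFmax, hgmin⟩ := Finset.exists_min_image Fmax (badBonds Gr) hFmaxne
  obtain ⟨hgF, hgZ⟩ := Finset.mem_filter.1 hgFmax
  have hgmax : ∀ g' ∈ F, Z g' ≤ Z g := fun g' hg' => hgZ ▸ hg₀max g' hg'
  -- claim: `g` has no bad bond
  have hN : badBonds Gr g = 0 := by
    by_contra hN0
    obtain ⟨e, he, hbad⟩ : ∃ e ∈ Gr.edgeFinset, badInd g e ≠ 0 := by
      by_contra hall
      push Not at hall
      exact hN0 (Finset.sum_eq_zero hall)
    obtain ⟨x, i, hxy⟩ : ∃ (x : TorusSite d L) (i : Fin d), e = s(x, x + Pi.single i 1) := by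
      induction e using Sym2.ind with
      | _ a b =>
        have hab : Gr.Adj a b := (SimpleGraph.mem_edgeFinset.1 he)
        rw [torusGraph_adj_iff] at hab
        rcases hab.2 with ⟨i, rfl⟩ | ⟨i, rfl⟩
        · exact ⟨a, i, rfl⟩
        · exact ⟨b, i, Sym2.eq_swap⟩
    subst hxy
    rw [badInd_mk] at hbad
    have hgx : g x ≠ g (x + Pi.single i 1) := by
      intro h'; rw [if_pos h'] at hbad; exact hbad rfl
    -- the reflection bisecting this bond
    set θ := Torus.reflectBetweenSites (d := d) (L := L) i (x i) with hθdef
    set P := (Torus.halfBetweenSites (d := d) (L := L) i (x i)).toFinset with hPdef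
    have hθθ : ∀ z, θ (θ z) = z := Torus.reflectBetweenSites_involutive i (x i)
    have hadj : ∀ a b, Gr.Adj (θ a) (θ b) ↔ Gr.Adj a b :=
      Torus.torusGraph_adj_reflectBetweenSites_iff i (x i)
    have hP : ∀ a, a ∈ P ↔ θ a ∉ P :=
      Torus.mem_halfBetweenSites_iff_reflect_not_mem hL i (x i)
    have hcross : ∀ a b, a ∈ P → b ∉ P → Gr.Adj a b → b = θ a := fun a b ha hb hab =>
      Torus.eq_reflectBetweenSites_of_adj hL hL4 i (x i) ha hb hab
    obtain ⟨hyP, hθy⟩ := Torus.add_single_mem_halfBetweenSites (by omega : 2 ≤ L) i x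
    -- `Z(g)² ≤ Z(g⁺) Z(g⁻)`
    have hsq : Z g ^ 2 ≤ Z (reflPlus θ P g) * Z (reflMinus θ P g) :=
      realGaussZ_sq_le_reflect (G := Gr) ν hν hθθ hadj hP hcross hβ g
    have hPF : reflPlus θ P g ∈ F := reflPlus_mem_piFinset hgF
    have hMF : reflMinus θ P g ∈ F := reflMinus_mem_piFinset hgF
    have hPle := hgmax _ hPF
    have hMle := hgmax _ hMF
    have hZg := hZpos g
    have hPpos := hZpos (reflPlus θ P g)
    have hMpos := hZpos (reflMinus θ P g)
    have hPeq : Z (reflPlus θ P g) = Z g := by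
      refine le_antisymm hPle ?_
      by_contra hlt
      push Not at hlt
      have : Z (reflPlus θ P g) * Z (reflMinus θ P g) < Z g * Z g :=
        mul_lt_mul hlt hMle hMpos hZg.le
      nlinarith
    have hMeq : Z (reflMinus θ P g) = Z g := by
      refine le_antisymm hMle ?_
      by_contra hlt
      push Not at hlt
      have : Z (reflPlus θ P g) * Z (reflMinus θ P g) < Z g * Z g :=
        mul_lt_mul' hPle hlt hMpos.le hZg
      nlinarith
    have hPmin : badBonds Gr g ≤ badBonds Gr (reflPlus θ P g) :=
      hgmin _ (Finset.mem_filter.2 ⟨hPF, hPeq.trans hgZ⟩)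
    have hMmin : badBonds Gr g ≤ badBonds Gr (reflMinus θ P g) :=
      hgmin _ (Finset.mem_filter.2 ⟨hMF, hMeq.trans hgZ⟩)
    have hcount := badBonds_reflPlus_add_reflMinus (G := Gr) hθθ hadj hP hcross g
    have hycross : x + Pi.single i 1 ∈ crossSites Gr θ P := by
      refine Finset.mem_filter.2 ⟨hyP, ?_⟩
      rw [hθy]
      exact (torusGraph_adj_add_single (by omega) x i).symm
    have hone : (1 : ℕ) ≤ ∑ z ∈ crossSites Gr θ P, badInd g s(z, θ z) := by
      calc (1 : ℕ) = badInd g s(x + Pi.single i 1, θ (x + Pi.single i 1)) := by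
            rw [badInd_mk, hθy, if_neg (Ne.symm hgx)]
        _ ≤ ∑ z ∈ crossSites Gr θ P, badInd g s(z, θ z) :=
          Finset.single_le_sum (f := fun z => badInd g s(z, θ z)) (fun z _ => Nat.zero_le _) hycross
    omega
  calc Z h ≤ Z g := hgmax h hhF
    _ = _ := realGaussZ_eq_of_badBonds_eq_zero (G := Gr) ν β hN

end TorusDescent

end Literature.MathematicalPhysics.QuantumLattice
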